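import Summits.HubbardSuperconductivity.HubbardSuperconductivity.Theorems.TwistGapTgCruxGlue
import Summits.HubbardSuperconductivity.HubbardSuperconductivity.Theorems.TwistGapTgCondensationOfRigidity
import Summits.HubbardSuperconductivity.HubbardSuperconductivity.Theorems.DeformationLadderLowEnergyRigidityInheritance

/-!
# Strategist (wall-breaker, gen 1 / p1) — split certificate for crux `LowEnergyRigidity`
# (stmt-HubbardSuperconductivity-1892), route DeformationLadder

Companion to `Cruxes/LowEnergyRigidity/STRATEGY-CENSUS.md` (v3, 2026-08-17).

§A  The decomposition FILED at route level (D1, dedup onto route TwistGap's two leaves):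
    the two children typed VERBATIM as TwistGap's `TgPairMomentumRigidity` (stmt-1509) and
    `TgLowEnergyCondensation` (stmt-1510), the proof that they are `rfl`-equal to those decls, the
    glue `LowEnergyRigidity_of_subs : PairMomentumRigidity → LowEnergyCondensation → LowEnergyRigidity`
    obtained BY NAME from the landed `TwistGap.lowEnergyRigidity_of_tgCruxes` (so `route edit --split …
    --glue-by` needs no new Theorems file), and the certificate that child 2 is a CONSEQUENCE of the
    crux (landed `tgLowEnergyCondensation_of_lowEnergyRigidity`) — i.e. child 2 is a genuine weakening
    (q = 0 relaxed to the `(2K+1)²` infrared window) and child 1 (universal zero-momentum selection,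
    no pairing content, does not imply S) carries exactly the `O(1) = O(L^{d-2})` stiffness bit.
§B  The alternative conditional split considered and NOT filed (census §Decomposition D2′):
    `OrderImpliesStiffness ∧ ThermodynamicDWaveOrder → LowEnergyRigidity`, glued by the landed
    inheritance composition `lowEnergyRigidity_of_condensationGap_of_mesoRigidity`; typed here so the
    census claim "it composes but has the same attack surface as 1509 and would be two NEW unstaffed
    items" is checkable.
No `sorry`; standard axioms only.
-/

set_option linter.dupNamespace false

namespace Summit.HubbardSuperconductivity.HubbardSuperconductivity.Cruxes.LowEnergyRigidity.SplitCheck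

open Summit.HubbardSuperconductivity.HubbardSuperconductivity.Theses.DeformationLadder (LowEnergyRigidity)
open Summit.HubbardSuperconductivity.HubbardSuperconductivity.Theses.TwistGap
  (TgPairMomentumRigidity TgLowEnergyCondensation)
open Summit.HubbardSuperconductivity.HubbardSuperconductivity.Theorems.TwistGap
  (lowEnergyRigidity_of_tgCruxes tgLowEnergyCondensation_of_lowEnergyRigidity)
open Summit.HubbardSuperconductivity.HubbardSuperconductivity.Theorems.LowEnergyRigidity
  (CondensationGapAt MesoRigidityAt lowEnergyRigidity_of_condensationGap_of_mesoRigidity)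

/-! ### §A  D1 — the filed split (children verbatim = TwistGap stmt-1509 / stmt-1510) -/

/-- Child 1 (= `TwistGap.TgPairMomentumRigidity`, stmt-1509, verbatim): universal pair-momentum
rigidity — macroscopic d-wave pair weight at a NONZERO infrared pair momentum costs total energy
linearly, up to an arbitrary slack. The `O(1)` stiffness half; no pairing claim; does not imply S. -/
def PairMomentumRigidity : Prop :=
  ∀ (U : ℝ), 0 < U → ∀ δ ∈ Set.Ioo (0:ℝ) (1/2), ∀ (K : ℕ) (σ : ℝ), 0 < σ → ∃ γ : ℝ, 0 < γ ∧ ∃ L₀ : ℕ, ∀ (L : ℕ) [NeZero L], L₀ ≤ L → Even L → ∀ φ : Literature.MathematicalPhysics.QuantumLattice.Fock (Literature.MathematicalPhysics.QuantumLattice.Orb (Literature.MathematicalPhysics.QuantumLattice.FermionTorus 2 L)), φ ∈ (Literature.MathematicalPhysics.QuantumLattice.szSector (2 * ⌊(1 - δ) * (L : ℝ) ^ 2 / 2⌋₊) 0) → star φ ⬝ᵥ φ = 1 → γ * ((∑ k ∈ (Finset.univ.filter (fun k : Literature.Probability.LatticeModels.TorusSite 2 L => k ≠ 0 ∧ ∀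 i : Fin 2, min (k i).val (L - (k i).val) ≤ K)), (Literature.MathematicalPhysics.QuantumLattice.expect (Matrix.conjTranspose (∑ x : Literature.Probability.LatticeModels.TorusSite 2 L, Complex.exp (-(2 * (Real.pi : ℂ) * Complex.I / (L : ℂ)) * ((∑ i : Fin 2, (k i).val * (x i).val : ℕ) : ℂ)) • Literature.MathematicalPhysics.QuantumLattice.localPair Literature.MathematicalPhysics.QuantumLattice.dWaveFormFactor L x) * (∑ x : Literature.Probability.LatticeModels.TorusSite 2 L, Complex.exp (-(2 * (Real.pi : ℂ) * Complex.I / (L : ℂ)) * ((∑ i : Fin 2, (k i).val * (x i).val : ℕ) : ℂ)) • Literature.MathematicalPhysics.QuantumLattice.localPair Literature.MathematicalPhysics.QuantumLattice.dWaveFormFactor L x)) φ).re / (L : ℝ) ^ 4) - σ) ≤ (Literature.MathematicalPhysics.QuantumLattice.expect (Literature.MathematicalPhysics.QuantumLattice.hubbardTorus 2 L 1 U) φ).re - (Literature.MathematicalPhysics.QuantumLattice.hubbardTorus 2 L 1 U).minEnergyOn (Literature.MathematicalPhysics.QuantumLattice.szSector (2 * ⌊(1 - δ) * (L : ℝ)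 ^ 2 / 2⌋₊) 0)

/-- Child 2 (= `TwistGap.TgLowEnergyCondensation`, stmt-1510, verbatim): existential low-energy
infrared condensation — at some `(U,δ)` every unit sector state within total energy `Γ` of `E₀`
carries d-wave pair weight `≥ θ` in the `(2K+1)²` longest-wavelength window (k = 0 included). A
consequence of the crux (`lowEnergyCondensation_of_lowEnergyRigidity` below), strictly weaker on
ground states (a Fulde–Ferrell ground state satisfies it). -/
def LowEnergyCondensation : Prop :=
  ∃ U : ℝ, 0 < U ∧ ∃ δ ∈ Set.Ioo (0:ℝ) (1/2), ∃ K : ℕ, ∃ θ : ℝ, 0 < θ ∧ ∃ Γ : ℝ, 0 < Γ ∧ ∃ L₀ : ℕ, ∀ (L : ℕ) [NeZero L], L₀ ≤ L → Even L → ∀ φ : Literature.MathematicalPhysics.QuantumLattice.Fock (Literature.MathematicalPhysics.QuantumLattice.Orb (Literature.MathematicalPhysics.QuantumLattice.FermionTorus 2 L)), φ ∈ (Literature.MathematicalPhysics.QuantumLattice.szSector (2 * ⌊(1 - δ) * (L : ℝ) ^ 2 / 2⌋₊) 0) → star φ ⬝ᵥ φ = 1 → (Literature.MathematicalPhysics.QuantumLattice.expect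 (Literature.MathematicalPhysics.QuantumLattice.hubbardTorus 2 L 1 U) φ).re ≤ (Literature.MathematicalPhysics.QuantumLattice.hubbardTorus 2 L 1 U).minEnergyOn (Literature.MathematicalPhysics.QuantumLattice.szSector (2 * ⌊(1 - δ) * (L : ℝ) ^ 2 / 2⌋₊) 0) + Γ → θ ≤ (∑ k ∈ (Finset.univ.filter (fun k : Literature.Probability.LatticeModels.TorusSite 2 L => ∀ i : Fin 2, min (k i).val (L - (k i).val) ≤ K)), (Literature.MathematicalPhysics.QuantumLattice.expect (Matrix.conjTranspose (∑ x : Literature.Probability.LatticeModels.TorusSite 2 L, Complex.exp (-(2 * (Real.pi : ℂ) * Complex.I / (L : ℂ)) * ((∑ i : Fin 2, (k i).val * (x i).val : ℕ) : ℂ)) • Literature.MathematicalPhysics.QuantumLattice.localPair Literature.MathematicalPhysics.QuantumLattice.dWaveFormFactor L x) * (∑ x : Literature.Probability.LatticeModels.TorusSite 2 L, Complex.exp (-(2 * (Real.pi : ℂ) * Complex.I / (L : ℂ)) * ((∑ i : Fin 2, (k i).val * (x i).val : ℕ) : ℂ)) • Literature.MathematicalPhysics.QuantumLattice.localPair Literature.MathematicalPhysics.QuantumLattice.dWaveFormFactor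 L x)) φ).re / (L : ℝ) ^ 4)

/-- The children ARE TwistGap's decls (syntactic identity of the bodies). -/
theorem children_eq :
    PairMomentumRigidity = TgPairMomentumRigidity ∧ LowEnergyCondensation = TgLowEnergyCondensation :=
  ⟨rfl, rfl⟩

/-- **Glue of the split, by name from the tree.** `Child₁ → Child₂ → LowEnergyRigidity` is the
landed `TwistGap.lowEnergyRigidity_of_tgCruxes` (Theorems/TwistGapTgCruxGlue.lean) up to `rfl`. -/
theorem LowEnergyRigidity_of_subs : PairMomentumRigidity → LowEnergyCondensation → LowEnergyRigidity :=
  fun h₁ h₂ => lowEnergyRigidity_of_tgCruxes h₁ h₂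

/-- Child 2 is NECESSARY for the crux (landed `tgLowEnergyCondensation_of_lowEnergyRigidity`,
window `K = 0`, `θ = a`, `Γ = κ`): the split loses nothing on that side. -/
theorem lowEnergyCondensation_of_lowEnergyRigidity : LowEnergyRigidity → LowEnergyCondensation :=
  fun h => tgLowEnergyCondensation_of_lowEnergyRigidity h

/-- Hence, given the universal stiffness child, the crux and its condensation child are
EQUIVALENT: all remaining existential / pairing content of `LowEnergyRigidity` sits in child 2,
all `O(1)` zero-mode content in child 1. -/
theorem lowEnergyRigidity_iff_condensation_of_rigidity (h₁ : PairMomentumRigidity) :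
    LowEnergyRigidity ↔ LowEnergyCondensation :=
  ⟨lowEnergyCondensation_of_lowEnergyRigidity, LowEnergyRigidity_of_subs h₁⟩

/-! ### §B  D2′ — the conditional inheritance split (typed and glued; NOT filed, see census) -/

/-- "Order implies stiffness", universally in `(U,δ)`: wherever mesoscopically unpaired states cost
extensive energy (`CondensationGapAt`), mesoscopic finite-momentum pair weight beyond any slack costs
`O(1)` total energy (`MesoRigidityAt`). Weaker than `∀ (U,δ), MesoRigidityAt U δ`; same attack
surface (phase separation with block condensation; SC/PDW Lifshitz point); no theorem of the form
"ODLRO ⇒ helicity modulus > 0" exists for any quantum model with `[H, order parameter] ≠ 0`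
(LiebSeiringerSolovejYngvason2005 p. 40: "neither condition is necessary for the other"). -/
def OrderImpliesStiffness : Prop :=
  ∀ U : ℝ, 0 < U → ∀ δ ∈ Set.Ioo (0 : ℝ) (1 / 2), CondensationGapAt U δ → MesoRigidityAt U δ

/-- Thermodynamic d-wave order of every energy-DENSITY minimiser at some `(U,δ)` (the inheritance
cut's extensive half; ⟸ KacWindowPenalty `WindowGap` stmt-1088 in Fejér dress). The summit's own
order content — engine-less at every coupling (barriers WeakCouplingCeiling,
PerturbativeInvisibilityOfPairing, GeneralizedHartreeFockNoPairing, StrongCouplingCeiling). -/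
def ThermodynamicDWaveOrder : Prop :=
  ∃ U : ℝ, 0 < U ∧ ∃ δ ∈ Set.Ioo (0 : ℝ) (1 / 2), CondensationGapAt U δ

/-- Glue of D2′ from the landed inheritance composition (three lines). -/
theorem lowEnergyRigidity_of_orderImpliesStiffness_of_order
    (hB : OrderImpliesStiffness) (hA : ThermodynamicDWaveOrder) : LowEnergyRigidity := by
  obtain ⟨U, hU, δ, hδ, hcond⟩ := hA
  exact lowEnergyRigidity_of_condensationGap_of_mesoRigidity hU hδ hcond (hB U hU δ hδ hcond)

end Summit.HubbardSuperconductivity.HubbardSuperconductivity.Cruxes.LowEnergyRigidity.SplitCheck
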